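import Mathlib
import Summits.Ventures.HodgeRepro2.Tier7.Line2.Galois
import Summits.Ventures.HodgeRepro2.Tier7.Line2.GaloisPeriod

/-!
# Tier7/Line2/GaloisBridge — the unconditional kernel bridge `C (PermDatum R r) ↔ C D`

The last module of the Line-2 Galois chain (SUPPORT for Line 3, STATUS ll. 14933 / 14978 / 14988 / 14991):
`GaloisDefs` (interface `RationalStructure`, `eigenPeriod`, `GaloisRationality`, lemma A) → `Galois` (`Realization`,
`PermDatum`, lemma C, the bridge `conclusion_perm_iff (hB : GaloisRationality R)`) → `GaloisPeriod`
(`galoisRationality R : GaloisRationality R` for every `R` — Tier 4's `f_forall` p387267 re-proved over the displayed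
fields) → this module: the displayed hypothesis discharged. What it buys Line 3: the residual `shrink ∧ orb_γ₀` may be
discharged on whichever of the three seesaw planes has the easiest local factors and transported back to `C D` (the
C-level bridge `conclusion_perm_iff'`); the `RtfConclusion`-level transfer needs the per-datum bridges on BOTH planes
(`rtfConclusion_perm_iff_of_bridges`; TowerBridge supplies each given the retraction + OrthDistinct on that plane).
§8(d): this module proposes NO L-value-free non-vanishing device — support only (flexibility of the plane).
-/

namespace Summit.Ventures.HodgeRepro2.Tier7.Line2.Galois

open Summit.Ventures.HodgeRepro2.Tier7

variable {K : Type} [Field K] [NumberField K] {E' : Type} [Field E'] [NumberField E']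
  {V : Type} [AddCommGroup V] [Module E' V] {HX : Type} [Ring HX] [Algebra ℂ HX]
  {G : Type} [Group G] [MulAction G HX] {D : PeriodDatum K E' V HX G}

/-- THE KERNEL BRIDGE, unconditional: for every rational structure `R` on `D` and every realization `r` of the face,
the conclusion for the permuted datum is equivalent to the conclusion for `D`. -/
theorem conclusion_perm_iff' (R : RationalStructure D) (r : Realization R) :
    (∃ g : Fin 4 → G, (PermDatum R r).S.L2 ((PermDatum R r).fOmegaS g) ((PermDatum R r).fOmegaSbar g) ≠ 0) ↔
      (∃ g : Fin 4 → G, D.S.L2 (D.fOmegaS g) (D.fOmegaSbar g) ≠ 0) :=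
  conclusion_perm_iff (galoisRationality R) r

/-- Transport of `Line3.RtfConclusion` from the TWO per-datum bridges `RtfConclusion ↔ C` — one for `D`, one for the
permuted datum (the tree supplies each under a Hecke-equivariant retraction onto `H10 * H10` + `OrthDistinct`
(`TowerBridge.rtfConclusion_iff_conclusion_of_retraction` p666660) or finite dimension (`ProjHX` p666013)); this is
the USABLE form (t7-crit-2 STATUS l. 15045: a universal bridge `∀ D', …` is not in the tree). -/
theorem rtfConclusion_perm_iff_of_bridges (R : RationalStructure D) (r : Realization R)
    (hD : Line3.RtfConclusion D ↔ (∃ g : Fin 4 → G, D.S.L2 (D.fOmegaS g) (D.fOmegaSbar g) ≠ 0))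
    (hP : Line3.RtfConclusion (PermDatum R r) ↔
      (∃ g : Fin 4 → G, (PermDatum R r).S.L2 ((PermDatum R r).fOmegaS g) ((PermDatum R r).fOmegaSbar g) ≠ 0)) :
    Line3.RtfConclusion (PermDatum R r) ↔ Line3.RtfConclusion D := by
  rw [hD, hP]
  exact conclusion_perm_iff' R r

/-- Transport of `Line3.RtfConclusion` under a universal per-datum bridge (kept for the record; the usable form is
`rtfConclusion_perm_iff_of_bridges`). -/
theorem rtfConclusion_perm_iff' (R : RationalStructure D) (r : Realization R)
    (hbridge : ∀ D' : PeriodDatum K E' V HX G,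
      Line3.RtfConclusion D' ↔ (∃ g : Fin 4 → G, D'.S.L2 (D'.fOmegaS g) (D'.fOmegaSbar g) ≠ 0)) :
    Line3.RtfConclusion (PermDatum R r) ↔ Line3.RtfConclusion D :=
  rtfConclusion_perm_iff_of_bridges R r (hbridge D) (hbridge _)

end Summit.Ventures.HodgeRepro2.Tier7.Line2.Galois
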